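import Summits.Ventures.HodgeRepro2.T5SU11LegendreSeriesRate

/-!
# The rate of convergence of the Legendre series of a `C²` function: `sup_{[−1,1]} |f − S_d f| ≤ ‖L f‖₂ / d`

The `C²` companion of row 425 (`O(d⁻³)` for `C⁴`): for `f` twice differentiable on `[−1, 1]` with continuous
second derivative (`hf`, `hf'`, `hf''` as in row 422) the coefficients satisfy `c_k(f) = −c_k(Lf)/(k(k + 1))` with
`Lf = ((1 − x²) f′)′` (row 422), the weights `v_j = √((2j + 1)/2)/(j(j + 1))` satisfy `v_j² ≤ 1/j³`
(`weight_sq_le'`) and `Σ_{k<n} v_{k+d+1}² ≤ d⁻²` (`sum_weight_sq_le'`), so Cauchy–Schwarz, Bessel for `Lf`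
(row 420) and row 423's error bound `|f − S_d f| ≤ Σ_{k>d} |c_k(f)|` give

  **`|f(x) − S_d f(x)| ≤ √(∫_{−1}^{1} (Lf)²) / d` for every `x ∈ [−1, 1]` and `d ≥ 1`**
  (`abs_sub_partialSum_le_div`, and `abs_sub_partialSum_le_div_of_contDiff` for `f ∈ C²(ℝ)`):

the Legendre series of a `C²` function converges uniformly with the rate `O(d⁻¹)` and the explicit constant
`‖Lf‖₂`. Nothing is claimed about (N).

Blind lane: Mathlib + the HodgeRepro2 prefix only; no sorry; axioms ⊆ {propext, Classical.choice,
Quot.sound}.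
-/

namespace Summit.Ventures.HodgeRepro2.T5SU11LegendreSeriesRateC2

open Polynomial intervalIntegral Finset Filter Topology MeasureTheory
open Set (Icc Ioc Ioo uIcc uIoc EqOn)
open T5SU11SphericalLegendreAll T5SU11LegendreIdentities T5SU11LegendreOrthogonal
  T5SU11LegendreSeries T5SU11LegendreCoefficientDecay T5SU11LegendreSeriesUniform T5SU11LegendreSeriesRate

/-! ### The weight sums -/

/-- The weight `v_j = √((2j + 1)/2)/(j(j + 1))` satisfies `v_j² ≤ 1/j³` (`j ≥ 1`). -/
theorem weight_sq_le' {j : ℕ} (hj : 1 ≤ j) :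
    (Real.sqrt ((2 * (j : ℝ) + 1) / 2) / ((j : ℝ) * ((j : ℝ) + 1))) ^ 2 ≤ 1 / (j : ℝ) ^ 3 := by
  have hj' : (1 : ℝ) ≤ (j : ℝ) := by exact_mod_cast hj
  rw [div_pow, Real.sq_sqrt (by positivity), div_le_div_iff₀ (by positivity) (by positivity), one_mul]
  -- `(2j + 1)/2 · j³ ≤ (j(j + 1))²`, i.e. `(2j + 1) j³ ≤ 2 j² (j + 1)²`
  have h2 : ((j : ℝ) * ((j : ℝ) + 1)) ^ 2 = (j : ℝ) ^ 2 * ((j : ℝ) + 1) ^ 2 := by ring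
  rw [h2]
  have h3 : (0 : ℝ) ≤ (j : ℝ) ^ 2 := by positivity
  have h1 : (2 * (j : ℝ) + 1) * (j : ℝ) ≤ 2 * ((j : ℝ) + 1) ^ 2 := by nlinarith
  have h4 : (2 * (j : ℝ) + 1) * (j : ℝ) ^ 3 ≤ 2 * ((j : ℝ) ^ 2 * ((j : ℝ) + 1) ^ 2) := by
    have := mul_le_mul_of_nonneg_left h1 h3
    nlinarith [this]
  linarith

/-- **`Σ_{k<n} v_{k+d+1}² ≤ 1/d²`** for `d ≥ 1`. -/
theorem sum_weight_sq_le' {d : ℕ} (hd : 1 ≤ d) (n : ℕ) :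
    ∑ k ∈ range n, (Real.sqrt ((2 * ((k + (d + 1) : ℕ) : ℝ) + 1) / 2)
        / (((k + (d + 1) : ℕ) : ℝ) * (((k + (d + 1) : ℕ) : ℝ) + 1))) ^ 2 ≤ 1 / (d : ℝ) ^ 2 := by
  have hd' : (1 : ℝ) ≤ (d : ℝ) := by exact_mod_cast hd
  calc ∑ k ∈ range n, (Real.sqrt ((2 * ((k + (d + 1) : ℕ) : ℝ) + 1) / 2)
          / (((k + (d + 1) : ℕ) : ℝ) * (((k + (d + 1) : ℕ) : ℝ) + 1))) ^ 2
      ≤ ∑ k ∈ range n, 1 / (d : ℝ) * (1 / ((k : ℝ) + d + 1) ^ 2) := by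
        refine Finset.sum_le_sum fun k _ => ?_
        refine (weight_sq_le' (by omega)).trans ?_
        push_cast
        rw [show (k : ℝ) + ((d : ℝ) + 1) = (k : ℝ) + d + 1 by ring]
        have hk : (d : ℝ) ≤ (k : ℝ) + d + 1 := by linarith [(Nat.cast_nonneg k : (0 : ℝ) ≤ k)]
        have hpos : (0 : ℝ) < (k : ℝ) + d + 1 := by positivity
        rw [div_mul_div_comm, one_mul, div_le_div_iff₀ (by positivity) (by positivity), one_mul, one_mul]
        calc (d : ℝ) * ((k : ℝ) + d + 1) ^ 2 ≤ ((k : ℝ) + d + 1) * ((k : ℝ) + d + 1) ^ 2 :=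
              mul_le_mul_of_nonneg_right hk (by positivity)
          _ = ((k : ℝ) + d + 1) ^ 3 := by ring
    _ = 1 / (d : ℝ) * ∑ k ∈ range n, 1 / ((k : ℝ) + d + 1) ^ 2 := by rw [Finset.mul_sum]
    _ ≤ 1 / (d : ℝ) * (1 / d) := by
        refine mul_le_mul_of_nonneg_left ((sum_inv_sq_shift_le hd n).trans ?_) (by positivity)
        have : (0 : ℝ) ≤ 1 / ((n : ℝ) + d) := by positivity
        linarith
    _ = 1 / (d : ℝ) ^ 2 := by
        field_simp

/-! ### The rate -/

section C2

variable {f f' f'' : ℝ → ℝ}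
  (hf : ∀ x ∈ Icc (-1 : ℝ) 1, HasDerivAt f (f' x) x)
  (hf' : ∀ x ∈ Icc (-1 : ℝ) 1, HasDerivAt f' (f'' x) x)
  (hf'' : ContinuousOn f'' (Icc (-1 : ℝ) 1))
include hf hf' hf''

/-- **The tail of the coefficient series of a `C²` function**: `Σ_{k<n} |c_{k+d+1}(f)| ≤ √(∫ (Lf)²) / d` for every
`n` (`d ≥ 1`). -/
theorem sum_abs_fourierLegendre_shift_le' {d : ℕ} (hd : 1 ≤ d) (n : ℕ) :
    ∑ k ∈ range n, |fourierLegendre f (k + (d + 1))|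
      ≤ Real.sqrt (∫ x in (-1 : ℝ)..1, sturm f' f'' x ^ 2) / (d : ℝ) := by
  set g := sturm f' f'' with hg
  have hgc : ContinuousOn g (Icc (-1 : ℝ) 1) := continuousOn_sturm hf' hf''
  have hd' : (1 : ℝ) ≤ (d : ℝ) := by exact_mod_cast hd
  have hfac : ∀ k ∈ range n, |fourierLegendre f (k + (d + 1))|
      = (|fourierLegendre g (k + (d + 1))| * Real.sqrt (2 / (2 * ((k + (d + 1) : ℕ) : ℝ) + 1)))
        * (Real.sqrt ((2 * ((k + (d + 1) : ℕ) : ℝ) + 1) / 2)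
          / (((k + (d + 1) : ℕ) : ℝ) * (((k + (d + 1) : ℕ) : ℝ) + 1))) := by
    intro k _
    have hk1 : 1 ≤ k + (d + 1) := by omega
    have hkpos : (0 : ℝ) < ((k + (d + 1) : ℕ) : ℝ) * (((k + (d + 1) : ℕ) : ℝ) + 1) := by positivity
    rw [fourierLegendre_eq_sturm hf hf' hf'' hk1, abs_div, abs_neg, abs_of_pos hkpos]
    have hs : Real.sqrt (2 / (2 * ((k + (d + 1) : ℕ) : ℝ) + 1))
        * Real.sqrt ((2 * ((k + (d + 1) : ℕ) : ℝ) + 1) / 2) = 1 := by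
      rw [← Real.sqrt_mul (by positivity)]
      have : (2 / (2 * ((k + (d + 1) : ℕ) : ℝ) + 1)) * ((2 * ((k + (d + 1) : ℕ) : ℝ) + 1) / 2) = 1 := by
        field_simp
      rw [this, Real.sqrt_one]
    calc |fourierLegendre g (k + (d + 1))| / (((k + (d + 1) : ℕ) : ℝ) * (((k + (d + 1) : ℕ) : ℝ) + 1))
        = |fourierLegendre g (k + (d + 1))|
            * (Real.sqrt (2 / (2 * ((k + (d + 1) : ℕ) : ℝ) + 1))
              * Real.sqrt ((2 * ((k + (d + 1) : ℕ) : ℝ) + 1) / 2))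
            / (((k + (d + 1) : ℕ) : ℝ) * (((k + (d + 1) : ℕ) : ℝ) + 1)) := by rw [hs, mul_one]
      _ = _ := by ring
  rw [Finset.sum_congr rfl hfac]
  refine (Real.sum_mul_le_sqrt_mul_sqrt _ _ _).trans ?_
  have hB : ∑ k ∈ range n, (|fourierLegendre g (k + (d + 1))|
      * Real.sqrt (2 / (2 * ((k + (d + 1) : ℕ) : ℝ) + 1))) ^ 2 ≤ ∫ x in (-1 : ℝ)..1, g x ^ 2 := by
    have e : ∀ k ∈ range n, (|fourierLegendre g (k + (d + 1))|
        * Real.sqrt (2 / (2 * ((k + (d + 1) : ℕ) : ℝ) + 1))) ^ 2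
        = fourierLegendre g (k + (d + 1)) ^ 2 * (2 / (2 * ((k + (d + 1) : ℕ) : ℝ) + 1)) := by
      intro k _
      rw [mul_pow, sq_abs, Real.sq_sqrt (by positivity)]
    rw [Finset.sum_congr rfl e]
    refine (sum_shift_le (F := fun j => fourierLegendre g j ^ 2 * (2 / (2 * (j : ℝ) + 1)))
      (fun j => by positivity) d n).trans ?_
    have := bessel hgc (n + d)
    rwa [show n + d + 1 = n + (d + 1) by ring] at this
  have hW := sum_weight_sq_le' hd n
  have hBnn : 0 ≤ ∫ x in (-1 : ℝ)..1, g x ^ 2 := integral_nonneg (by norm_num) fun x _ => sq_nonneg _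
  calc Real.sqrt (∑ k ∈ range n, (|fourierLegendre g (k + (d + 1))|
          * Real.sqrt (2 / (2 * ((k + (d + 1) : ℕ) : ℝ) + 1))) ^ 2)
        * Real.sqrt (∑ k ∈ range n, (Real.sqrt ((2 * ((k + (d + 1) : ℕ) : ℝ) + 1) / 2)
          / (((k + (d + 1) : ℕ) : ℝ) * (((k + (d + 1) : ℕ) : ℝ) + 1))) ^ 2)
      ≤ Real.sqrt (∫ x in (-1 : ℝ)..1, g x ^ 2) * Real.sqrt (1 / (d : ℝ) ^ 2) := by gcongr
    _ = Real.sqrt (∫ x in (-1 : ℝ)..1, g x ^ 2) / (d : ℝ) := by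
        have : Real.sqrt (1 / (d : ℝ) ^ 2) = 1 / (d : ℝ) := by
          rw [show (1 : ℝ) / (d : ℝ) ^ 2 = (1 / (d : ℝ)) ^ 2 by ring]
          exact Real.sqrt_sq (by positivity)
        rw [this]
        ring

/-- **THE RATE `O(d⁻¹)` FOR `C²` FUNCTIONS**: `|f(x) − S_d f(x)| ≤ √(∫_{−1}^{1} (Lf)²) / d` for every `x ∈ [−1, 1]`
and `d ≥ 1`. -/
theorem abs_sub_partialSum_le_div {d : ℕ} (hd : 1 ≤ d) {x : ℝ} (hx : x ∈ Icc (-1 : ℝ) 1) :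
    |f x - partialSum f d x| ≤ Real.sqrt (∫ x in (-1 : ℝ)..1, sturm f' f'' x ^ 2) / (d : ℝ) := by
  refine (abs_sub_partialSum_le hf hf' hf'' d hx).trans ?_
  exact Real.tsum_le_of_sum_range_le (fun k => abs_nonneg _)
    fun n => sum_abs_fourierLegendre_shift_le' hf hf' hf'' hd n

end C2

/-- **The rate `O(d⁻¹)` for every `f ∈ C²(ℝ)`**, with `Lf` built from `deriv f` and `deriv (deriv f)`. -/
theorem abs_sub_partialSum_le_div_of_contDiff {f : ℝ → ℝ} (hf : ContDiff ℝ 2 f) {d : ℕ} (hd : 1 ≤ d) {x : ℝ}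
    (hx : x ∈ Icc (-1 : ℝ) 1) :
    |f x - partialSum f d x|
      ≤ Real.sqrt (∫ x in (-1 : ℝ)..1, sturm (deriv f) (deriv (deriv f)) x ^ 2) / (d : ℝ) :=
  let ⟨h1, h2, h3⟩ := hasDerivAt_of_contDiff hf
  abs_sub_partialSum_le_div h1 h2 h3 hd hx

end Summit.Ventures.HodgeRepro2.T5SU11LegendreSeriesRateC2
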